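import Summits.BirchSwinnertonDyer.Rank1Residual.Additive.RankOneUpperHalfUnitRows
import Summits.BirchSwinnertonDyer.Rank1Residual.Additive.GordIsogenyInvarianceClasses
import Summits.BirchSwinnertonDyer.Rank1Residual.X12.CMIsogenyInvariance
import Literature.NumberTheory.EllipticCurves.Wuthrich2014.ShaBoundProofs
import Literature.NumberTheory.EllipticCurves.ComplexMultiplicationLFunctionIsogenyHoldsProofs
import HarnessLib

/-!
# (S10i) Unit-literal rank-ONE class corollaries ACROSS A `ℚ`-ISOGENY: `BSD(E,p)` for an X3 rank-one
# curve `E` whose unit literal `p ∤ #Ш_an` is read on an ISOGENOUS curve `E₀` (cell `b2b-bsdres`,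
# team n1011, seat p16 GEN 4; census-facing sequel of (S10) `RankOneUpperHalfUnitRows.lean`, p262041;
# OWNERS row T-S8X3-K, finding F5 of `HOME/b2b-bsdres-n1011-p16/g4/CENSUS-S8X3.md`)

HONEST FRAMING (cell `b2b-bsdres`, run/shared/lean/b2b/bsd-rank1-residual/, verbatim in every
file): the goal of the cell is to DELETE the COMBINATION-SHAPED residual classes of the
Birch–Swinnerton-Dyer formula for ALL analytic-rank `≤ 1` elliptic curves over `ℚ` — "full BSD
formula for every rank `≤ 1` curve in class `C`" assembled STRICTLY from published theorems — so
that the rank-`≤ 1` remainder becomes exactly the CONSTRUCTION-SHAPED classes, which are TYPED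
(missing-input `Prop`s), NOT attempted. This is not "finishing BSD". Team n1011 (O7 `r = 1` strand),
seat p16: research route; X3♯(G-ord) / X3♯(M) / O7 stay CONSTRUCTION-SHAPED; nothing is booked by this
file; no Literature fact is minted; theorems only (no `def`, no `sorry`).

WHY. On X3 (`E[p]` reducible) a rational `p`-isogeny moves `p`-powers between `#Ш_an`, `∏ c_ℓ` and
`#E(ℚ)_tors²` inside the isogeny class, so the unit literal `p ∤ #Ш_an(E)` of (S10) is NOT a class
invariant, while `BSD(E,p)` is (Cassels 1965). Census (T-S8X3-K, `p = 3`, Cremona `N < 5·10⁵`): the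
O7-ord X3@3 rank-one universe of record (Gord3 2 411 + M 4 383 = 6 794 classes) has `3 ∣ #Ш_an` at the
class label on 9 classes (215118bd1, 196794ci1, 491985u1; 235620bk1, 335331f1, 412794t1, 492660bw1,
155610c1, 459684b1) and in EACH of them a `3`-isogenous Cremona curve has `#Ш_an = 1`. The theorems
below are the kernel form of "read (S10) on the isogenous unit curve `E₀`, transport by Cassels": the
(S10) hypotheses are stated AT `E₀` (class membership of `E₀` follows from that of `E` by additive-p2's
`ClassX3Gord.of_isIsogenous`; for (M) it is a binder at `E₀`; `¬CM` transfers by x1b/X12's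
`hasCM_iff_of_isIsogenous`; the analytic rank by `analyticRank_eq_of_isIsogenous'`), and the conclusion
is `BSDp E p` for `E` through `Wuthrich2014.bsdp_of_isIsogenous` (Cassels' invariance of the BSD
quotient = the named fact `bsdRHS_eq_of_isIsogenous`, `hCassels`; `Ш(E₀)` finite by GZK; `L'(E₀,1) ≠ 0`).
Mathematically nothing new (bookkeeping); structurally it lets a census record cite ONE declaration per
class. Typed inputs (`BranchPAdicGrossZagier[Odd|Mult]At`, the Schneider rider, the (B)-datum) are the
(S10) ones, AT `E₀`; census literals `hq₀` / `hv₀` (Cremona allbsd) are EVIDENCE when instantiated.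

* `ClassX3Gord.bsdp_three_rankOne_of_isIsogenous_of_wuthrichHalf_of_delbourgo_of_forall_branchPAdicGrossZagierOdd_of_shaAn_unit`
  — X3♯(G-ord)@3 (the 3 Gord3 classes);
* `ClassX3Gord.bsdp_rankOne_of_isIsogenous_of_wuthrichHalf_of_branchPAdicGrossZagierOdd_of_shaAn_unit` —
  odd branch `p ≡ 3 (mod 4)`, explicit (B)-datum at `E₀`;
* `ClassX3M.bsdp_rankOne_of_isIsogenous_of_wuthrichHalf_of_delbourgo_of_forall_branchPAdicGrossZagierMult_of_shaAn_unit`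
  — X3♯(M), every odd `p` (the 6 M classes at `p = 3`);
* `ClassX3M.bsdp_rankOne_of_isIsogenous_of_wuthrichHalf_of_branchPAdicGrossZagierMult_of_shaAn_unit` —
  explicit (B)-datum at `E₀`.

References: J. W. S. Cassels, *Arithmetic on curves of genus 1. VIII*, J. reine angew. Math. 217
(1965) 180–199 (isogeny invariance; J. S. Milne, *ADT* I Thm. 7.3); C. Wuthrich, Doc. Math. 19 (2014)
Thm. 16; D. Delbourgo, J. Number Theory 95 (2002) Thm. (A), (B); R. L. Miller, LMS J. Comput. Math. 14
(2011) Def. 1.1.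
-/

noncomputable section

open scoped Classical MatrixGroups ModularForm NumberField

open CongruenceSubgroup WeierstrassCurve NumberField Literature.NumberTheory.EllipticCurves
  Literature.NumberTheory.EllipticCurves.ModularForms
  Literature.NumberTheory.EllipticCurves.Rank1Residual
  Literature.NumberTheory.EllipticCurves.Rank1Residual.Typed
  Literature.NumberTheory.EllipticCurves.Delbourgo2002
  Summit.BirchSwinnertonDyer.Rank1Residual.X12

namespace Summit.BirchSwinnertonDyer.Rank1Residual.Additive

variable {W W₀ : WeierstrassCurve ℚ} [W.IsElliptic] [W.IsGloballyMinimal] [W₀.IsElliptic]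
  [W₀.IsGloballyMinimal]

/-- **X3♯(G-ord)@3, `r_an(E) = 1`: `BSD(E,3)` from the unit literal `3 ∤ #Ш_an(E₀)` of an ISOGENOUS
curve `E₀`.** Hypotheses: Cassels' invariance (`hCassels`, named fact), Delbourgo 2002 at `3` (`hDel3`),
Wuthrich Thm. 16 half-eigen (`hWu`), GZK, modularity; `ClassX3Gord E 3`, `E` non-CM (Delbourgo at `3`), `r_an(E) = 1`,
`E ∼ E₀`, the typed inputs of (S10) AT `E₀` for every Delbourgo (B)-datum (`hGZ₀`), and the census
literal `#Ш_an(E₀) = q₀`, `ord₃ q₀ = 0`. Proof: `E₀ ∈` X3♯(G-ord) (`ClassX3Gord.of_isIsogenous`),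
`E₀` non-CM (`hasCM_iff_of_isIsogenous`), `r_an(E₀) = 1` (`analyticRank_eq_of_isIsogenous'`), (S10) at
`E₀`, Cassels back to `E`.
[cite: Wuthrich2014, Thm. 16 (p. 397)] [cite: Delbourgo2002, Theorem (A), (B) (p. 40)]
[cite: Miller2011LMS, Def. 1.1] -/
theorem ClassX3Gord.bsdp_three_rankOne_of_isIsogenous_of_wuthrichHalf_of_delbourgo_of_forall_branchPAdicGrossZagierOdd_of_shaAn_unit
    [Fact (Nat.Prime 3)] (hCassels : bsdRHS_eq_of_isIsogenous) (hDel3 : Delbourgo2002.mainTheorem_three)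
    (hWu : Wuthrich2014.thm16_halfEigenCharIdeal_dvd_cyclotomicPrime)
    (hGZK : rank_eq_analyticRank_of_analyticRank_le_one) (hmod : hasEntireLFunction_rat)
    (hmodD : nonempty_modularParametrizationData) (hX : ClassX3Gord W 3) (hr : W.analyticRank = 1)
    (hcm : ¬ W.HasCM) (hiso : IsIsogenous W W₀)
    (hGZ₀ : ∀ Dh : PAdicHeightData W₀ 3, LeadingTermClauses W₀ 3 Dh →
      SchneiderConjecture Dh ∧ BranchPAdicGrossZagierOddAt W₀ 3 Dh)
    {q₀ : ℚ} (hq₀ : shaAn W₀ = (q₀ : ℂ)) (hv₀ : padicValRat 3 q₀ = 0) : BSDp W 3 := by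
  have hX₀ : ClassX3Gord W₀ 3 := hX.of_isIsogenous (by norm_num) hiso
  have hcm₀ : ¬ W₀.HasCM := fun h ↦ hcm ((hasCM_iff_of_isIsogenous hiso).mpr h)
  have hr₀ : W₀.analyticRank = 1 := by rw [← analyticRank_eq_of_isIsogenous' hiso]; exact hr
  exact Wuthrich2014.bsdp_of_isIsogenous hCassels hiso (hGZK W₀ (by rw [hr₀])).2
    (W₀.leadingLCoeff_ne_zero_holds (hmod W₀))
    (ClassX3Gord.bsdp_three_rankOne_of_wuthrichHalf_of_delbourgo_of_forall_branchPAdicGrossZagierOdd_of_shaAn_unit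
      hDel3 hWu hGZK hmod hmodD hX₀ hcm₀ hr₀ hGZ₀ hq₀ hv₀)

/-- **X3♯(G-ord, `e = 2`), odd branch `p ≡ 3 (mod 4)` (incl. `3`), `r_an(E) = 1`: `BSD(E,p)` from an
explicit Delbourgo (B)-datum, rider and typed GZ AT an isogenous `E₀` and the unit literal `p ∤ #Ш_an(E₀)`**
(`e(E₀) = e(E) = 2` by additive-p2's `semistabilityIndex_eq_of_isIsogenous_of_typeG_of_addv`).
[cite: Wuthrich2014, Thm. 16 (p. 397)] [cite: Delbourgo2002, Theorem (B) (p. 40)] [cite: Miller2011LMS, Def. 1.1] -/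
theorem ClassX3Gord.bsdp_rankOne_of_isIsogenous_of_wuthrichHalf_of_branchPAdicGrossZagierOdd_of_shaAn_unit
    {p : ℕ} [Fact p.Prime] (hCassels : bsdRHS_eq_of_isIsogenous)
    (hWu : Wuthrich2014.thm16_halfEigenCharIdeal_dvd_cyclotomicPrime)
    (hGZK : rank_eq_analyticRank_of_analyticRank_le_one) (hmod : hasEntireLFunction_rat)
    (hmodD : nonempty_modularParametrizationData) (hX : ClassX3Gord W p)
    (he : semistabilityIndex W p = 2) (hp4 : p % 4 = 3) (hr : W.analyticRank = 1)
    (hiso : IsIsogenous W W₀) {Dh : PAdicHeightData W₀ p} (hB₀ : LeadingTermClauses W₀ p Dh)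
    (hS₀ : SchneiderConjecture Dh) (hGZ₀ : BranchPAdicGrossZagierOddAt W₀ p Dh)
    {q₀ : ℚ} (hq₀ : shaAn W₀ = (q₀ : ℂ)) (hv₀ : padicValRat p q₀ = 0) : BSDp W p := by
  have hp2 : p ≠ 2 := by omega
  have hX₀ : ClassX3Gord W₀ p := hX.of_isIsogenous hp2 hiso
  -- the defect `e = 2` is a class invariant on the additive (G)-cell (additive-p2 gen 15)
  have he₀ : semistabilityIndex W₀ p = 2 := by
    rw [semistabilityIndex_eq_of_isIsogenous_of_typeG_of_addv hp2 hX.addv hX.typeGOrd.typeG hiso]; exact he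
  have hr₀ : W₀.analyticRank = 1 := by rw [← analyticRank_eq_of_isIsogenous' hiso]; exact hr
  exact Wuthrich2014.bsdp_of_isIsogenous hCassels hiso (hGZK W₀ (by rw [hr₀])).2
    (W₀.leadingLCoeff_ne_zero_holds (hmod W₀))
    (ClassX3Gord.bsdp_rankOne_of_wuthrichHalf_of_branchPAdicGrossZagierOdd_of_shaAn_unit hWu hGZK hmod hmodD
      hX₀ he₀ hp4 hr₀ hB₀ hS₀ hGZ₀ hq₀ hv₀)

end Summit.BirchSwinnertonDyer.Rank1Residual.Additive

namespace Summit.BirchSwinnertonDyer.Rank1Residual.AdditivePotMult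

open Additive Summit.BirchSwinnertonDyer.Rank1Residual.X12

variable {W W₀ : WeierstrassCurve ℚ} [W.IsElliptic] [W.IsGloballyMinimal] [W₀.IsElliptic]
  [W₀.IsGloballyMinimal] {p : ℕ} [Fact p.Prime]

/-- **X3♯(M), every odd `p`, `r_an(E) = 1`: `BSD(E,p)` from the unit literal `p ∤ #Ш_an(E₀)` of an
ISOGENOUS curve `E₀ ∈` X3♯(M)** (class membership stated AT `E₀` — potentially multiplicative reduction
and reducibility are class properties, read per row), Delbourgo 2002 (M) supplying the (B)-datum
(`hDelM`), the typed inputs of (S10) AT `E₀` (`hGZ₀`), Wuthrich Thm. 16 half-eigen, GZK, modularity,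
Cassels (`hCassels`). [cite: Wuthrich2014, Thm. 16 (p. 397)] [cite: Delbourgo2002, Theorem (A), (B) (p. 40)]
[cite: Miller2011LMS, Def. 1.1] -/
theorem ClassX3M.bsdp_rankOne_of_isIsogenous_of_wuthrichHalf_of_delbourgo_of_forall_branchPAdicGrossZagierMult_of_shaAn_unit
    (hCassels : bsdRHS_eq_of_isIsogenous) (hDelM : Delbourgo2002.mainTheorem_potMult)
    (hW16 : Wuthrich2014.thm16_halfEigenCharIdeal_dvd_cyclotomicPrime)
    (hGZK : rank_eq_analyticRank_of_analyticRank_le_one) (hmod : hasEntireLFunction_rat)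
    (hmodD : nonempty_modularParametrizationData) (hr : W.analyticRank = 1)
    (hiso : IsIsogenous W W₀) (hX₀ : ClassX3M W₀ p)
    (hGZ₀ : ∀ Dh : PAdicHeightData W₀ p, LeadingTermClauses W₀ p Dh →
      SchneiderConjecture Dh ∧ BranchPAdicGrossZagierMultAt W₀ p Dh)
    {q₀ : ℚ} (hq₀ : shaAn W₀ = (q₀ : ℂ)) (hv₀ : padicValRat p q₀ = 0) : BSDp W p := by
  have hr₀ : W₀.analyticRank = 1 := by rw [← analyticRank_eq_of_isIsogenous' hiso]; exact hr
  exact Wuthrich2014.bsdp_of_isIsogenous hCassels hiso (hGZK W₀ (by rw [hr₀])).2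
    (W₀.leadingLCoeff_ne_zero_holds (hmod W₀))
    (ClassX3M.bsdp_rankOne_of_wuthrichHalf_of_delbourgo_of_forall_branchPAdicGrossZagierMult_of_shaAn_unit
      hDelM hW16 hGZK hmod hmodD hX₀ hr₀ hGZ₀ hq₀ hv₀)

/-- **X3♯(M), every odd `p`, `r_an(E) = 1`: `BSD(E,p)` from an explicit (B)-datum, rider and typed
multiplicative-branch GZ AT an isogenous `E₀ ∈` X3♯(M) and the unit literal `p ∤ #Ш_an(E₀)`.**
[cite: Wuthrich2014, Thm. 16 (p. 397)] [cite: Delbourgo2002, Theorem (B) (p. 40)] [cite: Miller2011LMS, Def. 1.1] -/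
theorem ClassX3M.bsdp_rankOne_of_isIsogenous_of_wuthrichHalf_of_branchPAdicGrossZagierMult_of_shaAn_unit
    (hCassels : bsdRHS_eq_of_isIsogenous)
    (hW16 : Wuthrich2014.thm16_halfEigenCharIdeal_dvd_cyclotomicPrime)
    (hGZK : rank_eq_analyticRank_of_analyticRank_le_one) (hmod : hasEntireLFunction_rat)
    (hmodD : nonempty_modularParametrizationData) (hr : W.analyticRank = 1)
    (hiso : IsIsogenous W W₀) (hX₀ : ClassX3M W₀ p)
    {Dh : PAdicHeightData W₀ p} (hB₀ : LeadingTermClauses W₀ p Dh) (hS₀ : SchneiderConjecture Dh)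
    (hGZ₀ : BranchPAdicGrossZagierMultAt W₀ p Dh)
    {q₀ : ℚ} (hq₀ : shaAn W₀ = (q₀ : ℂ)) (hv₀ : padicValRat p q₀ = 0) : BSDp W p := by
  have hr₀ : W₀.analyticRank = 1 := by rw [← analyticRank_eq_of_isIsogenous' hiso]; exact hr
  exact Wuthrich2014.bsdp_of_isIsogenous hCassels hiso (hGZK W₀ (by rw [hr₀])).2
    (W₀.leadingLCoeff_ne_zero_holds (hmod W₀))
    (ClassX3M.bsdp_rankOne_of_wuthrichHalf_of_branchPAdicGrossZagierMult_of_shaAn_unit hW16 hGZK hmod hmodD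
      hX₀ hr₀ hB₀ hS₀ hGZ₀ hq₀ hv₀)

end Summit.BirchSwinnertonDyer.Rank1Residual.AdditivePotMult

end
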